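import Summits.QuantumFields.BalabanUV.Beta.GAN24.HkGradientContinuumKernel
import Summits.QuantumFields.BalabanUV.Beta.GAN24.HkContinuumKernelLimit

/-!
# G-an2-4 ∕ (CONV-C), route R7 (ρ3) GRADIENT PART — THE NAMED `η → 0` GRADIENT KERNEL `dHc ν t` OF BAŁABAN's FINE MINIMISER AT `U = 1`, EVERY
# TORUS, AND ITS IDENTIFICATION WITH THE OFFSET-DERIVATIVE OF INTENT 1's `η → 0` KERNEL `Hc t`: tail `CDK·η^{α∕2}·e^{−dec|·|}`, decay, `α`-HÖLDER in the
# block offset, and `‖Hc(t + σe_ν) − Hc t − σ·dHc ν t‖ ≤ CHR(d,α)·σ^{1+α}·e^{−dec|·|}` — `Hc` is `C^{1,α}` in the offset for every `α < 1` (NOT `C^{1,1}`)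
# — PART 2 of 2 of INTENT 2 «DHK-CONTINUUM-KERNEL» (PART 1 = `HkGradientContinuumKernel`)

G-an2-4 formalisation swarm `b2b-balaban-gan24-formalise-*`, leaf prover 06 (gen 38), crux team (2) under the ruling «YM REDIRECT» (e34b3e0c; FREEZE (0)
honoured; INTENT 2, journal `HOME/CLAIMS.log` 2026-08-21 l.32403, hold-off honoured — the road-P2 chair's first refusal; idea-1 g13 GO + price
W-idea1-g13-1).  NOT IN PRINT; OUR BOOKKEEPING over tree theorems BY NAME.  INPUTS: PART 1 (`exists_limit_of_pairwise_rate_gen`, `norm_dker_floor_sub_floor_le`,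
`norm_dker_bpt_sub_bpt_le`, the rate lemmas, `CDK`), INTENT 1's `HkContinuumKernel` (`floor_lt_level`, `abs_floor_sub_floor_le`) and
`HkContinuumKernelLimit.exists_HkOp_continuum_kernel` (the kernel `Hc`), the chair's `HkGradientSecant` (`rayPt`, `hker_ray_step`, `norm_dker_ray_sub_le`,
`sum_range_mul_sub`: the in-block ray and the telescoping of `dker = n·(shift − id)`), b05's `norm_dker_bpt_le` (the k-uniform decay `CdecD`).
WHAT IS PROVED (0 sorry, 0 def; `E := e^{−dec(d)·|rep ȳ′ − rep ȳ|_{T,∞}}`, `0 < α < 1`): §0 `le_of_forall_rate`; §1 **`exists_dker_entry_limit`** (`∃ g`: tail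
`‖∂_νH_n((n·ȳ′+⌊n t⌋,μ),(ȳ,λ)) − g‖ ≤ CDK·n^{−α∕2}·E` for EVERY `n ≥ 1`, size `‖g‖ ≤ (CdecD + CDK)·E`, `Tendsto` along coherent digits); §2
**`norm_sub_le_of_dker_tails`** (two limits at admissible `t, t′` differ by `≤ CHR·(Σ_i|t_i − t′_i|)^α·E` — α-HÖLDER in the offset, sharp in class);
§3 `update_admissible`, **`norm_sub_sub_smul_le_of_tails`** (THE IDENTIFICATION: `H`-tails `s, s′` at `t, t + σe_ν` and the `∂_ν`-tail `g` at `t` give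
`‖s′ − s − σ·g‖ ≤ CHR·σ^{1+α}·E` — at level `n`, `H_n(⌊n t′⌋) − H_n(⌊n t⌋) = n⁻¹·Σ_{i<j} ∂_νH_n(⌊n t⌋ + i e_ν)`, `j = ⌊n(t_ν+σ)⌋ − ⌊n t_ν⌋`, each summand within
`CHR·(j∕n)^α·E` of `∂_νH_n(⌊n t⌋)`, `|j∕n − σ| < n⁻¹`, `n → ∞`); §4 **`exists_continuum_kernel_C1`** (the census declaration: `∃ Hc dHc` with (A) the
`H`-tail, (B) the `∂_ν`-tails ∕ decay ∕ `Tendsto`, (C) α-Hölder, (D) the Taylor bound).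
HONEST SCOPE.  [folklore] corollary BY NAME + real analysis; `U = 1`; every torus; constants crude, `d`- and `α`-only; `dHc` chosen entrywise, NAMED not
identified with any printed object (idea-1 (γ)); `C^{1,α}` for every `α < 1` and NOT `C^{1,1}` (idea-1 (α): mixed second derivatives are log-divergent on the
block skeleton — no such upgrade is claimed); «`C^{1,α}`» is the READING of (C)+(D) — what is TYPED is the one-sided coordinate Taylor bound with α-Hölder
partial limits (Fréchet differentiability on the open cube follows classically but is NOT separately typed); rate `η^{α∕2}` crude (idea-1 (β)); NOT (CONV-C) as typed, NEVER «G-an2-4 closed», NOT NE2 ∕ NE3, NOT D1, NOT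
BetaPertH, NOT continuum YM, NOT Clay; 0 def, 0 cite tag, no sorry.  Locators (text only): [Balaban1984PropagatorsI] (1.63) p. 28, p. 29 ll. 1–2; [King1986]
p. 664; [Balaban1987RG1] p. 264.  HONEST DEPENDENCY: continuum YM on T⁴ ⇐ BetaPertH ∧ nine spine estimates (0/9 proved); BetaPertH ⇐ (D1) ∧ (D4) ∧ CAP+tail;
G-an2-4 gates asym, D1 and NE2/3/4.  Provenance: prover-b2b-balaban-gan24-formalise-leaf-06-g38-0 (unit `b2b-balaban-gan24-formalise-leaf-06`, gen 38), 2026-08-21.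
-/


noncomputable section

open scoped BigOperators ComplexConjugate Matrix Topology
open Finset

namespace Summit.QuantumFields.BalabanUV.Beta.GAN24.HkGradientContinuumKernelLimit

open Filter
open Literature.MathematicalPhysics.QuantumFieldTheory.Balaban1983to89
open Literature.MathematicalPhysics.QuantumFieldTheory.Balaban1983to89.B5Prop11Plancherel (Tor fine)
open Literature.MathematicalPhysics.QuantumFieldTheory.Balaban1983to89.B4ContourShift (supNorm supNorm_nonneg abs_le_supNorm)
open Literature.MathematicalPhysics.QuantumFieldTheory.Balaban1983to89.B4TorusKernel (periodConst)
open Literature.MathematicalPhysics.QuantumFieldTheory.Balaban1983to89.B4TorusKernel.MultiPeriod (torusSupNorm)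
open Literature.MathematicalPhysics.QuantumFieldTheory.Balaban1983to89.B5Block118 (bpt)
open Literature.MathematicalPhysics.QuantumFieldTheory.Balaban1983to89.B5Kernel166Decay (periodConst_pos)
open Literature.MathematicalPhysics.QuantumFieldTheory.Balaban1983to89.B6LowerBound2153Torus (toT rep toT_rep)
open Literature.MathematicalPhysics.QuantumFieldTheory.Balaban1983to89.B5Hk163Strip (kappa163 kappa163_pos)
open Literature.MathematicalPhysics.QuantumFieldTheory.Balaban1983to89.B5Hk163Decay (MG163)
open Literature.MathematicalPhysics.QuantumFieldTheory.Balaban1983to89.B5Hk163Torus (hker HkOp)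
open Literature.MathematicalPhysics.QuantumFieldTheory.Balaban1983to89.B5Hk163TorusHolder (dker)
open Literature.MathematicalPhysics.QuantumFieldTheory.Balaban1983to89.B5Hk163TorusHolderDecay (CdecD CdecD_nonneg norm_dker_bpt_le)
open Literature.MathematicalPhysics.QuantumFieldTheory.Balaban1983to89.B5Hk163TorusHolderRate (CHR CHR_nonneg)
open Literature.MathematicalPhysics.QuantumFieldTheory.Balaban1983to89.T4Hk163StripRate (CGe)
open Summit.QuantumFields.BalabanUV.Beta.GAN24.HkKingOneStep (dec dec_pos KHd KHd_nonneg)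
open Summit.QuantumFields.BalabanUV.Beta.GAN24.HkGradientSecant (rayOff rayPt rayPt_zero hker_ray_step norm_dker_ray_sub_le sum_range_mul_sub)
open Summit.QuantumFields.BalabanUV.Beta.GAN24.HkGradientKingRate (dec_eq)
open Summit.QuantumFields.BalabanUV.Beta.GAN24.HkContinuumKernel (floor_lt_level abs_floor_sub_floor_le tendsto_inv_natCast_succ)
open Summit.QuantumFields.BalabanUV.Beta.GAN24.HkContinuumKernelLimit (exists_HkOp_continuum_kernel)
open Summit.QuantumFields.BalabanUV.Beta.GAN24.HkGradientContinuumKernel (exists_limit_of_pairwise_rate_gen rate_le_rate tendsto_rate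
  rpow_neg_le_rate norm_dker_bpt_sub_bpt_le supNorm_sub_le norm_dker_floor_sub_floor_le CDK CDK_nonneg le_of_forall_rate update_admissible)

variable {d : ℕ}

/-! ## §1 The limit of one gradient entry at one continuum offset -/

section Limit

variable (M : Fin (d + 1) → ℕ) [hM : ∀ μ, NeZero (M μ)]

/-- **THE LIMIT OF ONE GRADIENT ENTRY AT ONE CONTINUUM OFFSET** (`0 < α < 1`): for `t ∈ [0,1)^{d+1}` there is `g ∈ ℂ` with
(tail) `‖∂_νH_n((n·ȳ′+⌊n t⌋,μ),(ȳ,λ)) − g‖ ≤ CDK(d,α)·n^{−α∕2}·E` for EVERY `n ≥ 1` and every admissible digit vector, (size) `‖g‖ ≤ (CdecD + CDK)·E`,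
(limit) `∂_νH_{k+1}((…⌊(k+1)t⌋…),…) → g` along any coherent digit choice.  PART 1 §0 on the level family with PART 1 §2's pairwise rate. [folklore] -/
theorem exists_dker_entry_limit (t : Fin (d + 1) → ℝ) (ht0 : ∀ i, 0 ≤ t i) (ht1 : ∀ i, t i < 1)
    (y' : Tor M) (μ ν : Fin (d + 1)) (y : Tor M) (lam : Fin (d + 1)) {α : ℝ} (hα0 : 0 < α) (hα1 : α < 1) :
    ∃ g : ℂ,
      (∀ (n : ℕ) [NeZero n] (a : Fin (d + 1) → Fin n), (∀ i, (a i : ℕ) = ⌊(n : ℝ) * t i⌋₊) →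
          ‖dker n M μ lam ν (bpt n M y' a) y - g‖
            ≤ CDK d α * (n : ℝ) ^ (-(α / 2)) * Real.exp (-(dec d * torusSupNorm M (rep M y' - rep M y)))) ∧
      ‖g‖ ≤ (CdecD d + CDK d α) * Real.exp (-(dec d * torusSupNorm M (rep M y' - rep M y))) ∧
      (∀ A : (k : ℕ) → (Fin (d + 1) → Fin (k + 1)), (∀ k i, (A k i : ℕ) = ⌊((k : ℝ) + 1) * t i⌋₊) →
          Tendsto (fun k : ℕ => dker (k + 1) M μ lam ν (bpt (k + 1) M y' (A k)) y) atTop (𝓝 g)) := by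
  let dg : (n : ℕ) → [NeZero n] → (Fin (d + 1) → Fin n) := fun n _ i => ⟨⌊(n : ℝ) * t i⌋₊, floor_lt_level n (ht0 i) (ht1 i)⟩
  let u : (n : ℕ) → [NeZero n] → ℂ := fun n _ => dker n M μ lam ν (bpt n M y' (dg n)) y
  set w := Real.exp (-(dec d * torusSupNorm M (rep M y' - rep M y))) with hw
  have hw0 : 0 < w := Real.exp_pos _
  have hpair : ∀ (n m : ℕ) [NeZero n] [NeZero m],
      ‖u m - u n‖ ≤ CDK d α * ((n : ℝ) ^ (-(α / 2)) + (m : ℝ) ^ (-(α / 2))) * w := by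
    intro n m _ _
    have h := norm_dker_floor_sub_floor_le (n := n) (m := m) M μ lam ν (rep M y') (rep M y) t ht0 (dg n) (dg m)
      (fun i => rfl) (fun i => rfl) hα0.le hα1
    rwa [toT_rep, toT_rep] at h
  obtain ⟨g, hlim, htail, hg⟩ := exists_limit_of_pairwise_rate_gen u (CDK_nonneg d α) hw0.le
    (fun n : ℕ => (n : ℝ) ^ (-(α / 2))) (rate_le_rate hα0.le) (tendsto_rate hα0) hpair
  have hdg : ∀ (n : ℕ) [NeZero n] (a : Fin (d + 1) → Fin n), (∀ i, (a i : ℕ) = ⌊(n : ℝ) * t i⌋₊) → a = dg n := by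
    intro n _ a ha; funext i; exact Fin.ext (ha i)
  refine ⟨g, fun n _ a ha => ?_, ?_, fun A hA => ?_⟩
  · rw [hdg n a ha]; exact htail n
  · have h1 : ‖u 1‖ ≤ CdecD d * w := by
      have := norm_dker_bpt_le 1 M μ lam ν (dg 1) (rep M y') (rep M y)
      rw [toT_rep, toT_rep] at this; rw [hw, dec_eq]; unfold CdecD; exact this
    calc ‖g‖ ≤ ‖u 1‖ + CDK d α * (((1 : ℕ) : ℝ)) ^ (-(α / 2)) * w := hg
      _ = ‖u 1‖ + CDK d α * w := by rw [Nat.cast_one, Real.one_rpow, mul_one]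
      _ ≤ CdecD d * w + CDK d α * w := add_le_add h1 le_rfl
      _ = (CdecD d + CDK d α) * w := by ring
  · have hfun : (fun k : ℕ => dker (k + 1) M μ lam ν (bpt (k + 1) M y' (A k)) y) = fun k : ℕ => u (k + 1) := by
      funext k
      have hAk : A k = dg (k + 1) := hdg (k + 1) (A k) (fun i => by rw [hA k i]; push_cast; rfl)
      rw [hAk]
    rw [hfun]; exact hlim

/-! ## §2 The limit is `α`-Hölder in the offset -/

/-- **TWO GRADIENT LIMITS AT TWO OFFSETS**: if `g` (resp. `g′`) obeys the `∂_ν`-tail (rate `K·n^{−α∕2}`) at the digits of admissible offsets `t`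
(resp. `t′`), then `‖g − g′‖ ≤ CHR(d,α)·(Σ_i |t_i − t′_i|)^α·E` — at level `n` the digit vectors differ by `≤ n·Σ_i|t_i − t′_i| + 1` in sup norm (PART 1
§1, `Real.rpow_add_le_add_rpow`), then `n → ∞` (§0). [folklore] -/
theorem norm_sub_le_of_dker_tails (t t' : Fin (d + 1) → ℝ) (ht0 : ∀ i, 0 ≤ t i) (ht1 : ∀ i, t i < 1) (ht0' : ∀ i, 0 ≤ t' i)
    (ht1' : ∀ i, t' i < 1) (y' : Tor M) (μ ν : Fin (d + 1)) (y : Tor M) (lam : Fin (d + 1)) {α : ℝ} (hα0 : 0 < α) (hα1 : α < 1)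
    {K : ℝ} {g g' : ℂ}
    (hg : ∀ (n : ℕ) [NeZero n] (a : Fin (d + 1) → Fin n), (∀ i, (a i : ℕ) = ⌊(n : ℝ) * t i⌋₊) →
      ‖dker n M μ lam ν (bpt n M y' a) y - g‖ ≤ K * (n : ℝ) ^ (-(α / 2)) * Real.exp (-(dec d * torusSupNorm M (rep M y' - rep M y))))
    (hg' : ∀ (n : ℕ) [NeZero n] (a : Fin (d + 1) → Fin n), (∀ i, (a i : ℕ) = ⌊(n : ℝ) * t' i⌋₊) →
      ‖dker n M μ lam ν (bpt n M y' a) y - g'‖ ≤ K * (n : ℝ) ^ (-(α / 2)) * Real.exp (-(dec d * torusSupNorm M (rep M y' - rep M y)))) :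
    ‖g - g'‖ ≤ CHR d α * (∑ i, |t i - t' i|) ^ α * Real.exp (-(dec d * torusSupNorm M (rep M y' - rep M y))) := by
  set w := Real.exp (-(dec d * torusSupNorm M (rep M y' - rep M y))) with hw
  have hw0 : 0 < w := Real.exp_pos _
  have hCHR := CHR_nonneg (d := d) α
  set S := ∑ i, |t i - t' i| with hS
  have hS0 : 0 ≤ S := Finset.sum_nonneg fun i _ => abs_nonneg _
  refine le_of_forall_rate (C := (2 * K + CHR d α) * w) hα0 fun n _ => ?_
  have hn : (0 : ℝ) < n := by exact_mod_cast Nat.pos_of_ne_zero (NeZero.ne n)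
  set a : Fin (d + 1) → Fin n := fun i => ⟨⌊(n : ℝ) * t i⌋₊, floor_lt_level n (ht0 i) (ht1 i)⟩ with ha
  set a' : Fin (d + 1) → Fin n := fun i => ⟨⌊(n : ℝ) * t' i⌋₊, floor_lt_level n (ht0' i) (ht1' i)⟩ with ha'
  have h1 := hg n a (fun i => rfl)
  have h2 := hg' n a' (fun i => rfl)
  have h3 : ‖dker n M μ lam ν (bpt n M y' a) y - dker n M μ lam ν (bpt n M y' a') y‖
      ≤ CHR d α * (supNorm (fun i => ((a i : ℕ) : ℤ) - ((a' i : ℕ) : ℤ)) / n) ^ α * w := by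
    have h := norm_dker_bpt_sub_bpt_le n M μ lam ν (rep M y') (rep M y) a a' hα0.le hα1
    rwa [toT_rep, toT_rep] at h
  -- the digit vectors differ by at most `n·S + 1` in sup norm
  have hdig : supNorm (fun i => ((a i : ℕ) : ℤ) - ((a' i : ℕ) : ℤ)) ≤ (n : ℝ) * S + 1 := by
    refine supNorm_sub_le n a a' fun i => ?_
    have h := abs_floor_sub_floor_le (x := (n : ℝ) * t i) (y := (n : ℝ) * t' i) (mul_nonneg hn.le (ht0 i)) (mul_nonneg hn.le (ht0' i))
    rw [← mul_sub, abs_mul, abs_of_pos hn] at h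
    have hi : |t i - t' i| ≤ S := by
      rw [hS]; exact Finset.single_le_sum (f := fun i => |t i - t' i|) (fun i _ => abs_nonneg _) (Finset.mem_univ i)
    refine h.trans ?_
    nlinarith
  have h3' : ‖dker n M μ lam ν (bpt n M y' a) y - dker n M μ lam ν (bpt n M y' a') y‖
      ≤ CHR d α * (S ^ α + (n : ℝ) ^ (-(α / 2))) * w := by
    refine h3.trans (mul_le_mul_of_nonneg_right (mul_le_mul_of_nonneg_left ?_ hCHR) hw0.le)
    have hq0 : 0 ≤ supNorm (fun i => ((a i : ℕ) : ℤ) - ((a' i : ℕ) : ℤ)) / n := div_nonneg (supNorm_nonneg _) hn.le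
    have hq : supNorm (fun i => ((a i : ℕ) : ℤ) - ((a' i : ℕ) : ℤ)) / n ≤ S + (n : ℝ)⁻¹ := by
      rw [div_le_iff₀ hn]
      refine hdig.trans (le_of_eq ?_)
      field_simp
    calc (supNorm (fun i => ((a i : ℕ) : ℤ) - ((a' i : ℕ) : ℤ)) / n) ^ α ≤ (S + (n : ℝ)⁻¹) ^ α := Real.rpow_le_rpow hq0 hq hα0.le
      _ ≤ S ^ α + ((n : ℝ)⁻¹) ^ α := Real.rpow_add_le_add_rpow hS0 (inv_nonneg.mpr hn.le) hα0.le hα1.le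
      _ = S ^ α + (n : ℝ) ^ (-α) := by rw [Real.inv_rpow hn.le, Real.rpow_neg hn.le]
      _ ≤ S ^ α + (n : ℝ) ^ (-(α / 2)) := add_le_add le_rfl (rpow_neg_le_rate hα0.le n)
  set U := dker n M μ lam ν (bpt n M y' a) y with hU
  set U' := dker n M μ lam ν (bpt n M y' a') y with hU'
  have htri : ‖g - g'‖ ≤ ‖U - g‖ + ‖U - U'‖ + ‖U' - g'‖ :=
    calc ‖g - g'‖ = ‖(U' - g') + (U - U') - (U - g)‖ := by congr 1; abel
      _ ≤ ‖(U' - g') + (U - U')‖ + ‖U - g‖ := norm_sub_le _ _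
      _ ≤ ‖U' - g'‖ + ‖U - U'‖ + ‖U - g‖ := add_le_add (norm_add_le _ _) le_rfl
      _ = ‖U - g‖ + ‖U - U'‖ + ‖U' - g'‖ := by ring
  refine htri.trans ((add_le_add (add_le_add h1 h3') h2).trans (le_of_eq ?_))
  ring

/-! ## §3 The identification: the `H`-limit is differentiable along `e_ν`, with derivative the `∂_ν`-limit -/
/-- **THE IDENTIFICATION `∂_νHc = dHc ν` AS A TAYLOR BOUND**: for `t ∈ [0,1)^{d+1}`, `σ ≥ 0`, `t_ν + σ < 1`: if `s`, `s′` obey INTENT 1's `H`-tail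
(rate `K₁·n⁻¹`) at the digits of `t`, `t + σ·e_ν` and `g` obeys the `∂_ν`-tail (rate `K₂·n^{−α∕2}`) at the digits of `t`, then
`‖s′ − s − σ·g‖ ≤ CHR(d,α)·σ^{1+α}·e^{−dec|y′−y|_T}` (telescoping the definition of `dker` along the in-block ray, the chair's `norm_dker_ray_sub_le`,
`|j∕n − σ| < n⁻¹`, `n → ∞`). [folklore] -/
theorem norm_sub_sub_smul_le_of_tails (t : Fin (d + 1) → ℝ) (ht0 : ∀ i, 0 ≤ t i) (ht1 : ∀ i, t i < 1) (ν : Fin (d + 1)) {σ : ℝ}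
    (hσ : 0 ≤ σ) (hσ1 : t ν + σ < 1) (y' : Tor M) (μ : Fin (d + 1)) (y : Tor M) (lam : Fin (d + 1)) {α : ℝ} (hα0 : 0 < α)
    (hα1 : α < 1) {K₁ K₂ : ℝ} {s s' g : ℂ}
    (hs : ∀ (n : ℕ) [NeZero n] (a : Fin (d + 1) → Fin n), (∀ i, (a i : ℕ) = ⌊(n : ℝ) * t i⌋₊) →
      ‖HkOp n M (bpt n M y' a, μ) (y, lam) - s‖ ≤ K₁ * ((n : ℝ))⁻¹ * Real.exp (-(dec d * torusSupNorm M (rep M y' - rep M y))))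
    (hs' : ∀ (n : ℕ) [NeZero n] (a : Fin (d + 1) → Fin n), (∀ i, (a i : ℕ) = ⌊(n : ℝ) * Function.update t ν (t ν + σ) i⌋₊) →
      ‖HkOp n M (bpt n M y' a, μ) (y, lam) - s'‖ ≤ K₁ * ((n : ℝ))⁻¹ * Real.exp (-(dec d * torusSupNorm M (rep M y' - rep M y))))
    (hg : ∀ (n : ℕ) [NeZero n] (a : Fin (d + 1) → Fin n), (∀ i, (a i : ℕ) = ⌊(n : ℝ) * t i⌋₊) →
      ‖dker n M μ lam ν (bpt n M y' a) y - g‖ ≤ K₂ * (n : ℝ) ^ (-(α / 2)) * Real.exp (-(dec d * torusSupNorm M (rep M y' - rep M y)))) :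
    ‖s' - s - (σ : ℂ) * g‖ ≤ CHR d α * σ ^ (1 + α) * Real.exp (-(dec d * torusSupNorm M (rep M y' - rep M y))) := by
  set w := Real.exp (-(dec d * torusSupNorm M (rep M y' - rep M y))) with hw
  have hw0 : 0 < w := Real.exp_pos _
  have hCHR := CHR_nonneg (d := d) α
  set t' := Function.update t ν (t ν + σ) with ht'
  -- the per-level estimate
  have key : ∀ (n : ℕ) [NeZero n], ‖s' - s - (σ : ℂ) * g‖
      ≤ 2 * K₁ * ((n : ℝ))⁻¹ * w + CHR d α * (σ + ((n : ℝ))⁻¹) ^ (1 + α) * w + (σ + 1) * K₂ * (n : ℝ) ^ (-(α / 2)) * w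
        + ((n : ℝ))⁻¹ * ‖g‖ := by
    intro n _
    have hn : (0 : ℝ) < n := by exact_mod_cast Nat.pos_of_ne_zero (NeZero.ne n)
    have hnC : (n : ℂ) ≠ 0 := by exact_mod_cast (NeZero.ne n)
    -- the digits of `t`, and the number `j` of ray steps to the digits of `t′`
    set a : Fin (d + 1) → Fin n := fun i => ⟨⌊(n : ℝ) * t i⌋₊, floor_lt_level n (ht0 i) (ht1 i)⟩ with ha
    have hfl : ⌊(n : ℝ) * t ν⌋₊ ≤ ⌊(n : ℝ) * (t ν + σ)⌋₊ := Nat.floor_le_floor (by nlinarith)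
    set j : ℕ := ⌊(n : ℝ) * (t ν + σ)⌋₊ - ⌊(n : ℝ) * t ν⌋₊ with hj
    have haj' : (a ν : ℕ) + j = ⌊(n : ℝ) * (t ν + σ)⌋₊ := by show ⌊(n : ℝ) * t ν⌋₊ + j = _; omega
    have haj : (a ν : ℕ) + j < n := by rw [haj']; exact floor_lt_level n (by linarith [ht0 ν]) hσ1
    have hdig' : ∀ i, ((rayOff n a ν j i : ℕ)) = ⌊(n : ℝ) * t' i⌋₊ := by
      intro i; rw [rayOff, dif_pos haj]
      by_cases hi : i = ν
      · subst hi; rw [Function.update_self, ht', Function.update_self]; exact haj'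
      · rw [Function.update_of_ne hi, ht', Function.update_of_ne hi]
    -- `j∕n` against `σ`
    have hjR : (j : ℝ) = (⌊(n : ℝ) * (t ν + σ)⌋₊ : ℝ) - (⌊(n : ℝ) * t ν⌋₊ : ℝ) := by rw [hj, Nat.cast_sub hfl]
    have hj_lt : (j : ℝ) < n * σ + 1 := by
      have h1 : ((⌊(n : ℝ) * (t ν + σ)⌋₊ : ℕ) : ℝ) ≤ n * (t ν + σ) := Nat.floor_le (by nlinarith [ht0 ν])
      have h2 : (n : ℝ) * t ν < ⌊(n : ℝ) * t ν⌋₊ + 1 := Nat.lt_floor_add_one _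
      rw [hjR]; nlinarith
    have hj_gt : (n : ℝ) * σ - 1 < j := by
      have h1 : (n : ℝ) * (t ν + σ) < ⌊(n : ℝ) * (t ν + σ)⌋₊ + 1 := Nat.lt_floor_add_one _
      have h2 : ((⌊(n : ℝ) * t ν⌋₊ : ℕ) : ℝ) ≤ n * t ν := Nat.floor_le (by nlinarith [ht0 ν])
      rw [hjR]; nlinarith
    have hq0 : (0 : ℝ) ≤ (j : ℝ) / n := by positivity
    have hq1 : (j : ℝ) / n ≤ σ + ((n : ℝ))⁻¹ := by
      rw [div_le_iff₀ hn, show (σ + ((n : ℝ))⁻¹) * n = n * σ + 1 by field_simp]; exact hj_lt.le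
    have hlow : σ - ((n : ℝ))⁻¹ ≤ (j : ℝ) / n := by
      rw [le_div_iff₀ hn, show (σ - ((n : ℝ))⁻¹) * n = n * σ - 1 by field_simp]; exact hj_gt.le
    have hq2 : |(j : ℝ) / n - σ| ≤ ((n : ℝ))⁻¹ := by rw [abs_le]; constructor <;> linarith
    -- the three tails at level `n`
    have h1 := hs n a (fun i => rfl)
    have h2 := hs' n (rayOff n a ν j) hdig'
    have h3 := hg n a (fun i => rfl)
    have hK₂ : 0 ≤ K₂ * (n : ℝ) ^ (-(α / 2)) * w := (norm_nonneg _).trans h3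
    -- the ray language
    set D : ℕ → ℂ := fun i => dker n M μ lam ν (rayPt n M (rep M y') a ν i) (toT M (rep M y)) with hD
    have eH : hker n M μ lam (rayPt n M (rep M y') a ν 0) (toT M (rep M y)) = HkOp n M (bpt n M y' a, μ) (y, lam) := by rw [rayPt_zero, toT_rep, toT_rep]; rfl
    have eH' : hker n M μ lam (rayPt n M (rep M y') a ν j) (toT M (rep M y)) = HkOp n M (bpt n M y' (rayOff n a ν j), μ) (y, lam) := by
      simp only [rayPt, toT_rep]; rfl
    have eD0 : D 0 = dker n M μ lam ν (bpt n M y' a) y := by simp only [hD, rayPt_zero, toT_rep]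
    -- telescoping the definition of `dker` along the ray
    have htel : (n : ℂ) * (HkOp n M (bpt n M y' (rayOff n a ν j), μ) (y, lam) - HkOp n M (bpt n M y' a, μ) (y, lam))
        = ∑ i ∈ range j, D i := by
      have h0 := sum_range_mul_sub (fun i => hker n M μ lam (rayPt n M (rep M y') a ν i) (toT M (rep M y))) (n : ℂ) j
      beta_reduce at h0; rw [eH, eH'] at h0; rw [← h0]
      refine Finset.sum_congr rfl fun i hi => ?_
      exact hker_ray_step n M μ lam ν (rep M y') (rep M y) a i (by have := Finset.mem_range.mp hi; omega)
    have hdev : ∀ i ∈ range j, ‖D i - D 0‖ ≤ CHR d α * ((j : ℝ) / n) ^ α * w := by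
      intro i hi
      have h := norm_dker_ray_sub_le n M μ lam ν (rep M y') (rep M y) a haj (Finset.mem_range.mp hi).le (Nat.zero_le j) hα0.le hα1
      rwa [← dec_eq] at h
    -- X := H′ − H − (j∕n)·D 0
    set H := HkOp n M (bpt n M y' a, μ) (y, lam) with hH
    set H' := HkOp n M (bpt n M y' (rayOff n a ν j), μ) (y, lam) with hH'
    have hX : ‖H' - H - ((j : ℂ) / n) * D 0‖ ≤ (j : ℝ) / n * (CHR d α * ((j : ℝ) / n) ^ α * w) := by
      have e : H' - H - ((j : ℂ) / n) * D 0 = ((n : ℂ))⁻¹ * ∑ i ∈ range j, (D i - D 0) := by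
        rw [Finset.sum_sub_distrib, Finset.sum_const, Finset.card_range, nsmul_eq_mul, ← htel]
        field_simp
      rw [e, norm_mul, norm_inv, Complex.norm_natCast]
      calc ((n : ℝ))⁻¹ * ‖∑ i ∈ range j, (D i - D 0)‖ ≤ ((n : ℝ))⁻¹ * ∑ i ∈ range j, ‖D i - D 0‖ :=
            mul_le_mul_of_nonneg_left (norm_sum_le _ _) (inv_nonneg.mpr hn.le)
        _ ≤ ((n : ℝ))⁻¹ * ∑ _i ∈ range j, CHR d α * ((j : ℝ) / n) ^ α * w :=
            mul_le_mul_of_nonneg_left (Finset.sum_le_sum hdev) (inv_nonneg.mpr hn.le)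
        _ = (j : ℝ) / n * (CHR d α * ((j : ℝ) / n) ^ α * w) := by
            rw [Finset.sum_const, Finset.card_range, nsmul_eq_mul]; ring
    -- the decomposition
    have hdec : s' - s - (σ : ℂ) * g
        = -(H' - s') + (H - s) + (H' - H - ((j : ℂ) / n) * D 0) + ((j : ℂ) / n) * (D 0 - g) + (((j : ℂ) / n) - σ) * g := by
      rw [eD0]; ring
    have hn1 : ‖-(H' - s')‖ ≤ K₁ * ((n : ℝ))⁻¹ * w := by rw [norm_neg]; exact h2
    have hn4 : ‖((j : ℂ) / n) * (D 0 - g)‖ ≤ (σ + 1) * K₂ * (n : ℝ) ^ (-(α / 2)) * w := by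
      rw [norm_mul, show ((j : ℂ) / n) = (((j : ℝ) / n : ℝ) : ℂ) by push_cast; rfl, Complex.norm_real,
        Real.norm_of_nonneg hq0, eD0]
      have hq1' : (j : ℝ) / n ≤ σ + 1 := hq1.trans (by
        have : ((n : ℝ))⁻¹ ≤ 1 := inv_le_one_of_one_le₀ (by exact_mod_cast Nat.pos_of_ne_zero (NeZero.ne n))
        linarith)
      calc (j : ℝ) / n * ‖dker n M μ lam ν (bpt n M y' a) y - g‖ ≤ (σ + 1) * (K₂ * (n : ℝ) ^ (-(α / 2)) * w) :=
            mul_le_mul hq1' h3 (norm_nonneg _) (by linarith)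
        _ = (σ + 1) * K₂ * (n : ℝ) ^ (-(α / 2)) * w := by ring
    have hn5 : ‖(((j : ℂ) / n) - σ) * g‖ ≤ ((n : ℝ))⁻¹ * ‖g‖ := by
      rw [norm_mul, show ((j : ℂ) / n - σ) = (((j : ℝ) / n - σ : ℝ) : ℂ) by push_cast; rfl, Complex.norm_real, Real.norm_eq_abs]
      exact mul_le_mul_of_nonneg_right hq2 (norm_nonneg _)
    have hn3 : ‖H' - H - ((j : ℂ) / n) * D 0‖ ≤ CHR d α * (σ + ((n : ℝ))⁻¹) ^ (1 + α) * w := by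
      refine hX.trans ?_
      have hpow : ((j : ℝ) / n) ^ α ≤ (σ + ((n : ℝ))⁻¹) ^ α := Real.rpow_le_rpow hq0 hq1 hα0.le
      have hσn : 0 < σ + ((n : ℝ))⁻¹ := by positivity
      calc (j : ℝ) / n * (CHR d α * ((j : ℝ) / n) ^ α * w) ≤ (σ + ((n : ℝ))⁻¹) * (CHR d α * (σ + ((n : ℝ))⁻¹) ^ α * w) :=
            mul_le_mul hq1 (mul_le_mul_of_nonneg_right (mul_le_mul_of_nonneg_left hpow hCHR) hw0.le) (by positivity) hσn.le
        _ = CHR d α * ((σ + ((n : ℝ))⁻¹) ^ (1 : ℝ) * (σ + ((n : ℝ))⁻¹) ^ α) * w := by rw [Real.rpow_one]; ring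
        _ = CHR d α * (σ + ((n : ℝ))⁻¹) ^ (1 + α) * w := by rw [← Real.rpow_add hσn]
    rw [hdec]
    calc ‖-(H' - s') + (H - s) + (H' - H - ((j : ℂ) / n) * D 0) + ((j : ℂ) / n) * (D 0 - g) + (((j : ℂ) / n) - σ) * g‖
        ≤ ‖-(H' - s')‖ + ‖H - s‖ + ‖H' - H - ((j : ℂ) / n) * D 0‖ + ‖((j : ℂ) / n) * (D 0 - g)‖ + ‖(((j : ℂ) / n) - σ) * g‖ := by
          refine (norm_add_le _ _).trans (add_le_add ((norm_add_le _ _).trans (add_le_add ((norm_add_le _ _).trans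
            (add_le_add (norm_add_le _ _) le_rfl)) le_rfl)) le_rfl)
      _ ≤ K₁ * ((n : ℝ))⁻¹ * w + K₁ * ((n : ℝ))⁻¹ * w + CHR d α * (σ + ((n : ℝ))⁻¹) ^ (1 + α) * w
            + (σ + 1) * K₂ * (n : ℝ) ^ (-(α / 2)) * w + ((n : ℝ))⁻¹ * ‖g‖ :=
          add_le_add (add_le_add (add_le_add (add_le_add hn1 h1) hn3) hn4) hn5
      _ = _ := by ring
  -- `n → ∞`
  have hlim : Tendsto (fun k : ℕ => 2 * K₁ * (((k : ℝ) + 1))⁻¹ * w + CHR d α * (σ + (((k : ℝ) + 1))⁻¹) ^ (1 + α) * w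
      + (σ + 1) * K₂ * (((k : ℝ) + 1)) ^ (-(α / 2)) * w + (((k : ℝ) + 1))⁻¹ * ‖g‖) atTop
      (𝓝 (2 * K₁ * 0 * w + CHR d α * (σ + 0) ^ (1 + α) * w + (σ + 1) * K₂ * 0 * w + 0 * ‖g‖)) := by
    have h0 := tendsto_inv_natCast_succ
    have hr : Tendsto (fun k : ℕ => (((k : ℝ) + 1)) ^ (-(α / 2))) atTop (𝓝 0) := by
      refine ((tendsto_rate hα0).comp (tendsto_add_atTop_nat 1)).congr fun k => ?_
      simp only [Function.comp_apply]
      push_cast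
      rfl
    have hp : Tendsto (fun k : ℕ => (σ + (((k : ℝ) + 1))⁻¹) ^ (1 + α)) atTop (𝓝 ((σ + 0) ^ (1 + α))) :=
      (tendsto_const_nhds.add h0).rpow_const (Or.inr (by linarith))
    exact ((((h0.const_mul (2 * K₁)).mul_const w).add ((hp.const_mul (CHR d α)).mul_const w)).add
      ((hr.const_mul ((σ + 1) * K₂)).mul_const w)).add (h0.mul_const ‖g‖)
  simp only [mul_zero, zero_mul, add_zero, zero_add] at hlim
  refine ge_of_tendsto hlim (Eventually.of_forall fun k => ?_)
  have hk := key (k + 1)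
  push_cast at hk
  exact hk

end Limit

/-! ## §4 The census declaration: `Hc` is `C^{1,α}` in the offset and `∂_νHc = dHc ν` is the limit of the lattice gradient kernels -/

section Census

variable (M : Fin (d + 1) → ℕ) [hM : ∀ μ, NeZero (M μ)]

/-- **THE `η → 0` KERNEL OF BAŁABAN's FINE MINIMISER IS `C^{1,α}` IN THE BLOCK OFFSET AND ITS GRADIENT IS THE `η → 0` LIMIT OF THE LATTICE GRADIENT
KERNELS `∂_ν^{(η)}H^{(η)}`** (`U = 1`, every torus, `0 < α < 1`; `E := e^{−dec(d)·|rep ȳ′ − rep ȳ|}`, `KHc := CGe(d+1)·periodConst + (d+1)·KHd(d)`): `∃ Hc dHc` with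
(A) `‖H_n((n·ȳ′+⌊n t⌋,μ),(ȳ,λ)) − Hc t (ȳ′,μ) (ȳ,λ)‖ ≤ KHc·n⁻¹·E` (every admissible `t`, every `n ≥ 1` — INTENT 1); (B) for every `ν` and admissible `t`:
`‖∂_νH_n((n·ȳ′+⌊n t⌋,μ),(ȳ,λ)) − dHc ν t (ȳ′,μ) (ȳ,λ)‖ ≤ CDK(d,α)·n^{−α∕2}·E` (every `n ≥ 1`), `‖dHc ν t (ȳ′,μ)(ȳ,λ)‖ ≤ (CdecD + CDK)·E`, `Tendsto` along
coherent digits; (C) `‖dHc ν t (·)(·) − dHc ν t′ (·)(·)‖ ≤ CHR(d,α)·(Σ_i |t_i − t′_i|)^α·E` (α-HÖLDER); (D) for `σ ≥ 0`, `t_ν + σ < 1`: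
`‖Hc (t + σ·e_ν) (·)(·) − Hc t (·)(·) − σ·dHc ν t (·)(·)‖ ≤ CHR(d,α)·σ^{1+α}·E` (`t + σ·e_ν` = `Function.update t ν (t ν + σ)`).  «`C^{1,α}`» is the
reading of (C)+(D) (one-sided coordinate Taylor bounds + Hölder partials; Fréchet differentiability not separately typed); NOT `C^{1,1}` (idea-1 g13 (α));
limits NAMED, not identified. [folklore] -/
theorem exists_continuum_kernel_C1 {α : ℝ} (hα0 : 0 < α) (hα1 : α < 1) :
    ∃ (Hc : (Fin (d + 1) → ℝ) → Matrix (Tor M × Fin (d + 1)) (Tor M × Fin (d + 1)) ℂ)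
      (dHc : Fin (d + 1) → (Fin (d + 1) → ℝ) → Matrix (Tor M × Fin (d + 1)) (Tor M × Fin (d + 1)) ℂ),
      (∀ (t : Fin (d + 1) → ℝ), (∀ i, 0 ≤ t i) → (∀ i, t i < 1) →
        ∀ (y' : Tor M) (μ : Fin (d + 1)) (y : Tor M) (lam : Fin (d + 1)) (n : ℕ) [NeZero n] (a : Fin (d + 1) → Fin n),
          (∀ i, (a i : ℕ) = ⌊(n : ℝ) * t i⌋₊) →
            ‖HkOp n M (bpt n M y' a, μ) (y, lam) - Hc t (y', μ) (y, lam)‖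
              ≤ (CGe (d + 1) * periodConst (kappa163 (d + 1)) d + (d + 1) * KHd d) * ((n : ℝ))⁻¹
                  * Real.exp (-(dec d * torusSupNorm M (rep M y' - rep M y)))) ∧
      (∀ (ν : Fin (d + 1)) (t : Fin (d + 1) → ℝ), (∀ i, 0 ≤ t i) → (∀ i, t i < 1) →
        ∀ (y' : Tor M) (μ : Fin (d + 1)) (y : Tor M) (lam : Fin (d + 1)),
          (∀ (n : ℕ) [NeZero n] (a : Fin (d + 1) → Fin n), (∀ i, (a i : ℕ) = ⌊(n : ℝ) * t i⌋₊) →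
              ‖dker n M μ lam ν (bpt n M y' a) y - dHc ν t (y', μ) (y, lam)‖
                ≤ CDK d α * (n : ℝ) ^ (-(α / 2)) * Real.exp (-(dec d * torusSupNorm M (rep M y' - rep M y)))) ∧
          ‖dHc ν t (y', μ) (y, lam)‖ ≤ (CdecD d + CDK d α) * Real.exp (-(dec d * torusSupNorm M (rep M y' - rep M y))) ∧
          (∀ A : (k : ℕ) → (Fin (d + 1) → Fin (k + 1)), (∀ k i, (A k i : ℕ) = ⌊((k : ℝ) + 1) * t i⌋₊) →
              Tendsto (fun k : ℕ => dker (k + 1) M μ lam ν (bpt (k + 1) M y' (A k)) y) atTop (𝓝 (dHc ν t (y', μ) (y, lam))))) ∧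
      (∀ (ν : Fin (d + 1)) (t t' : Fin (d + 1) → ℝ), (∀ i, 0 ≤ t i) → (∀ i, t i < 1) → (∀ i, 0 ≤ t' i) → (∀ i, t' i < 1) →
        ∀ (y' : Tor M) (μ : Fin (d + 1)) (y : Tor M) (lam : Fin (d + 1)),
          ‖dHc ν t (y', μ) (y, lam) - dHc ν t' (y', μ) (y, lam)‖
            ≤ CHR d α * (∑ i, |t i - t' i|) ^ α * Real.exp (-(dec d * torusSupNorm M (rep M y' - rep M y)))) ∧
      (∀ (ν : Fin (d + 1)) (t : Fin (d + 1) → ℝ), (∀ i, 0 ≤ t i) → (∀ i, t i < 1) → ∀ (σ : ℝ), 0 ≤ σ → t ν + σ < 1 →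
        ∀ (y' : Tor M) (μ : Fin (d + 1)) (y : Tor M) (lam : Fin (d + 1)),
          ‖Hc (Function.update t ν (t ν + σ)) (y', μ) (y, lam) - Hc t (y', μ) (y, lam) - (σ : ℂ) * dHc ν t (y', μ) (y, lam)‖
            ≤ CHR d α * σ ^ (1 + α) * Real.exp (-(dec d * torusSupNorm M (rep M y' - rep M y)))) := by
  obtain ⟨Hc, hHc, _hLip⟩ := exists_HkOp_continuum_kernel M
  -- choose the gradient limits entrywise (junk `0` off the admissible cube)
  have key : ∀ (ν : Fin (d + 1)) (t : Fin (d + 1) → ℝ) (i j : Tor M × Fin (d + 1)), ∃ g : ℂ, ((∀ k, 0 ≤ t k) → (∀ k, t k < 1) →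
      (∀ (n : ℕ) [NeZero n] (a : Fin (d + 1) → Fin n), (∀ k, (a k : ℕ) = ⌊(n : ℝ) * t k⌋₊) →
          ‖dker n M i.2 j.2 ν (bpt n M i.1 a) j.1 - g‖
            ≤ CDK d α * (n : ℝ) ^ (-(α / 2)) * Real.exp (-(dec d * torusSupNorm M (rep M i.1 - rep M j.1)))) ∧
      ‖g‖ ≤ (CdecD d + CDK d α) * Real.exp (-(dec d * torusSupNorm M (rep M i.1 - rep M j.1))) ∧
      (∀ A : (k : ℕ) → (Fin (d + 1) → Fin (k + 1)), (∀ k l, (A k l : ℕ) = ⌊((k : ℝ) + 1) * t l⌋₊) →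
          Tendsto (fun k : ℕ => dker (k + 1) M i.2 j.2 ν (bpt (k + 1) M i.1 (A k)) j.1) atTop (𝓝 g))) := by
    intro ν t i j
    by_cases ht : (∀ k, 0 ≤ t k) ∧ (∀ k, t k < 1)
    · obtain ⟨g, hg⟩ := exists_dker_entry_limit M t ht.1 ht.2 i.1 i.2 ν j.1 j.2 hα0 hα1
      exact ⟨g, fun _ _ => hg⟩
    · exact ⟨0, fun h0 h1 => (ht ⟨h0, h1⟩).elim⟩
  choose dg hdg using key
  refine ⟨Hc, fun ν t => Matrix.of fun i j => dg ν t i j, ?_, ?_, ?_, ?_⟩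
  · intro t h0 h1 y' μ y lam n _ a ha
    exact (hHc t h0 h1 y' μ y lam).1 n a ha
  · intro ν t h0 h1 y' μ y lam
    simp only [Matrix.of_apply]
    exact hdg ν t (y', μ) (y, lam) h0 h1
  · intro ν t t' h0 h1 h0' h1' y' μ y lam
    simp only [Matrix.of_apply]
    exact norm_sub_le_of_dker_tails M t t' h0 h1 h0' h1' y' μ ν y lam hα0 hα1 (hdg ν t (y', μ) (y, lam) h0 h1).1
      (hdg ν t' (y', μ) (y, lam) h0' h1').1
  · intro ν t h0 h1 σ hσ hσ1 y' μ y lam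
    simp only [Matrix.of_apply]
    obtain ⟨h0', h1'⟩ := update_admissible t h0 h1 ν hσ hσ1
    exact norm_sub_sub_smul_le_of_tails M t h0 h1 ν hσ hσ1 y' μ y lam hα0 hα1 (hHc t h0 h1 y' μ y lam).1
      (hHc _ h0' h1' y' μ y lam).1 (hdg ν t (y', μ) (y, lam) h0 h1).1

end Census

end Summit.QuantumFields.BalabanUV.Beta.GAN24.HkGradientContinuumKernelLimit

end
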